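import Literature.Analysis.ODE.ElementaryFieldDoubletonChainCertificateFast
import Literature.Analysis.ODE.ElementaryFieldDoubletonChainAssembly
import HarnessLib

/-!
# Doubleton chain checks assembled from per-stage checks — the fast checker

Trunk T-ANA (Analysis/ODE); namespace `Literature.Analysis.ODE`.

`ElementaryFieldDoubletonChainAssembly.lean` assembles the chain test `EDChainCert.check` from
per-stage checks proved in separate declarations / files (`EDChainCert.check_of_forall`) and
repackages the two conclusions of `EDChainCert.sound` for a box of initial values
(`mem_apriori_of_box`, `exists_of_box`, the mesh lemmas).  This file is the same layer for the FAST
chain test `EDChainCert.checkS` of `ElementaryFieldDoubletonChainCertificateFast.lean` (every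
hand-over decided by `EDStage.stepCheckS`, constant-folded Jacobian code lists):

* `edChainCheckS_of_forall`, `edChainCheckS_iff_forall` — the converse of
  `EDChainCert.edChainCheckS_spec` in list form;
* `EDChainCert.checkS_of_forall`, `checkS_iff_forall` — certificate vocabulary (`stageAt` /
  `nodeAt`): with the stage checks `hⱼ : (c.stageAt j).stepCheckS … (c.nodeAt (j+1)) = true`
  proved as separate theorems (one `decide +kernel` each, spread over files),
  `EDChainCert.checkS_of_forall c (fun j hj => by interval_cases j <;> assumption)`-style scripts
  assemble the chain in seconds;
* `EDChainCert.mem_apriori_of_boxS`, `exists_of_boxS`, `mesh_le_succS`, `mesh_monoS`,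
  `exists_mem_apriori_of_boxS` — the a-priori boxes `[Sⱼ]` on `[τⱼ, τⱼ₊₁]`, existence on
  `[0, τ_N]`, the monotone mesh and the covering of `[0, τ_N]` by the sub-intervals, from a BOX of
  initial values, all from `EDChainCert.soundS` (the time-covering lemma `exists_mesh_Icc` is the
  tree's, it does not depend on the test).

No new mathematics; structural induction on the stage list mirroring `edChainCheck_of_forall` and
repackagings of `EDChainCert.soundS`.  NOT COVERED: nothing about soundness changes —
`EDChainCert.soundS` / `eDoubletonChainVerifierS` are used as they are.

## References

* M. Mrozek, P. Zgliczyński, Ann. Polon. Math. 74 (2000), §7.5 Lemma 7.6, §8 Lemma 8.5. [MrozekZgliczynski2000]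
* R. E. Moore, *Methods and Applications of Interval Analysis*, SIAM 1979, §8.1 eq. (8.13). [Moore1979]
-/

set_option autoImplicit false

open Set NonemptyInterval Matrix
open scoped Pointwise
open Literature.Analysis.ValidatedNumerics Literature.Analysis.ValidatedNumerics.ITaylor
open Literature.Analysis.ODE.FExpr

namespace Literature.Analysis.ODE

variable {n : ℕ}

/-- Converse of `EDChainCert.edChainCheckS_spec`: if every stage of the list checks (fast) against
the next node (the last one against `fin`), the fast chain test `edChainCheckS` passes.
[cite: MrozekZgliczynski2000, Lemma 8.5] -/
theorem edChainCheckS_of_forall {F : Fin n → FExpr n} {cfg : SeedCfg} {R0 : Fin n → Iv}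
    {fin : DNode n} (pad : EDStage n) :
    ∀ l : List (EDStage n),
      (∀ j < l.length,
        (l.getD j pad).stepCheckS F cfg R0 ((l.map EDStage.node).getD (j + 1) fin) = true) →
      edChainCheckS F cfg R0 fin l = true
  | [], _ => rfl
  | s :: rest, h => by
    simp only [edChainCheckS, Bool.and_eq_true]
    refine ⟨?_, edChainCheckS_of_forall pad rest fun j hj => ?_⟩
    · have h0 := h 0 (by simp)
      simp only [List.getD_cons_zero, List.map_cons, List.getD_cons_succ, zero_add] at h0
      cases rest with
      | nil => simpa [edNext] using h0
      | cons s' rest' => simpa [edNext] using h0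
    · have := h (j + 1) (by simpa using hj)
      simpa only [List.getD_cons_succ, List.map_cons] using this

/-- `edChainCheckS` holds iff every stage checks (fast) against the next node.
[cite: MrozekZgliczynski2000, Lemma 8.5] -/
theorem edChainCheckS_iff_forall {F : Fin n → FExpr n} {cfg : SeedCfg} {R0 : Fin n → Iv}
    {fin : DNode n} (pad : EDStage n) (l : List (EDStage n)) :
    edChainCheckS F cfg R0 fin l = true ↔
      ∀ j < l.length,
        (l.getD j pad).stepCheckS F cfg R0 ((l.map EDStage.node).getD (j + 1) fin) = true :=
  ⟨fun h => EDChainCert.edChainCheckS_spec l h, edChainCheckS_of_forall pad l⟩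

/-- **Fast chain check from per-stage checks** (certificate vocabulary): if stage `j` checks (fast)
against node `j + 1` for every `j < N` (node `N` = the final node), then `c.checkS = true`.
[cite: MrozekZgliczynski2000, Lemma 8.5] -/
theorem EDChainCert.checkS_of_forall (c : EDChainCert n)
    (h : ∀ j < c.size, (c.stageAt j).stepCheckS c.field c.cfg c.r0 (c.nodeAt (j + 1)) = true) :
    c.checkS = true :=
  edChainCheckS_of_forall c.padStage c.stages h

/-- … and conversely (restating `EDChainCert.check_stageS` as an `iff`).
[cite: MrozekZgliczynski2000, Lemma 8.5] -/
theorem EDChainCert.checkS_iff_forall (c : EDChainCert n) :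
    c.checkS = true ↔
      ∀ j < c.size, (c.stageAt j).stepCheckS c.field c.cfg c.r0 (c.nodeAt (j + 1)) = true :=
  ⟨fun hc _ hj => c.check_stageS hc hj, c.checkS_of_forall⟩

/-- **A-priori boxes between mesh points, from a box of initial values** (fast checker; the
companion of `EDChainCert.mem_hull_of_boxS` for the second conclusion of `EDChainCert.soundS`): if
`C₀ = 1`, `0 ∈ [R₀]` and `W − x₀ ⊆ [R⁰]`, every solution from `y₀ ∈ W` on `[0, τ_N]` stays, on each
`[τⱼ, τⱼ₊₁]` (`j < N`), inside the stage's a-priori box `[Sⱼ]`.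
[cite: MrozekZgliczynski2000, §7.5 Lemma 7.6] [cite: Moore1979, §8.1 eq. (8.13)] -/
theorem EDChainCert.mem_apriori_of_boxS (c : EDChainCert n) (hc : c.checkS = true)
    (hC : isOneQ (c.nodeAt 0).cmat = true) (hR : boxLE (pointBox 0) (c.nodeAt 0).rem = true)
    {W : Fin n → Iv} (hW : boxLE (shiftBox W (c.nodeAt 0).center) c.r0 = true)
    {y : ℝ → Fin n → ℝ} (hy0 : y 0 ∈ boxSet (castBox W))
    (hy : ∀ t ∈ Icc (0 : ℝ) (c.toHOEChain.mesh c.size),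
      HasDerivWithinAt y (fieldFun c.field (y t)) (Icc (0 : ℝ) (c.toHOEChain.mesh c.size)) t)
    {j : ℕ} (hj : j < c.size) {t : ℝ} (ht : t ∈ Icc (c.toHOEChain.mesh j) (c.toHOEChain.mesh (j + 1))) :
    y t ∈ boxSet (castBox (c.stageAt j).apriori) :=
  ((c.soundS hc (boxSet_mono (castBox_mono (le_of_boxLE hW))
      (mem_boxSet_iff.2 fun l => sub_mem_shiftBox hy0 l))
    (DNode.start_mem hC hR (y 0))).2 y rfl hy).2 j hj t ht

/-- **Existence on `[0, τ_N]` from a box of initial values** (fast checker; first conclusion of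
`EDChainCert.soundS`, packaged like `mem_hull_of_boxS`). [cite: MrozekZgliczynski2000, Lemma 8.5]
[cite: Moore1979, §8.1 eq. (8.13)] -/
theorem EDChainCert.exists_of_boxS (c : EDChainCert n) (hc : c.checkS = true)
    (hC : isOneQ (c.nodeAt 0).cmat = true) (hR : boxLE (pointBox 0) (c.nodeAt 0).rem = true)
    {W : Fin n → Iv} (hW : boxLE (shiftBox W (c.nodeAt 0).center) c.r0 = true)
    {y₀ : Fin n → ℝ} (hy₀ : y₀ ∈ boxSet (castBox W)) :
    ∃ y : ℝ → Fin n → ℝ, y 0 = y₀ ∧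
      ∀ t ∈ Icc (0 : ℝ) (c.toHOEChain.mesh c.size),
        HasDerivWithinAt y (fieldFun c.field (y t)) (Icc (0 : ℝ) (c.toHOEChain.mesh c.size)) t :=
  (c.soundS hc (boxSet_mono (castBox_mono (le_of_boxLE hW))
      (mem_boxSet_iff.2 fun l => sub_mem_shiftBox hy₀ l))
    (DNode.start_mem hC hR y₀)).1

/-! ### Mesh monotonicity and the covering of `[0, τ_N]` (fast checker) -/

/-- Steps of the underlying transcript are the stages' steps (bookkeeping). [folklore] -/
private theorem EDChainCert.toHOEChain_stageAt_stepS (c : EDChainCert n) (j : ℕ) :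
    (c.toHOEChain.stageAt j).step = (c.stageAt j).step := by
  have h : c.toHOEChain.stageAt j = (c.stageAt j).toHOEStage := by
    show (c.stages.map EDStage.toHOEStage).getD j (EDStage.toHOEStage c.padStage) = _
    rw [List.getD_map]
    rfl
  rw [h]; rfl

/-- **The mesh is monotone** along a chain that checks (fast): `τⱼ ≤ τⱼ₊₁` for `j < N` (each stage
check certifies `0 ≤ hⱼ`). [cite: Moore1979, §8.1 eq. (8.13)] -/
theorem EDChainCert.mesh_le_succS (c : EDChainCert n) (hc : c.checkS = true) {j : ℕ} (hj : j < c.size) :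
    c.toHOEChain.mesh j ≤ c.toHOEChain.mesh (j + 1) := by
  have hE : ((c.stageAt j).cert c.field c.cfg).toE.check = true :=
    (EVarStepCert.checkS_spec (EMVStepCert.checkS_spec
      (EDStage.stepCheckS_spec (c.check_stageS hc hj)).1).1).1
  rw [HOEChainCert.mesh_succ, c.toHOEChain_stageAt_stepS]
  exact le_add_of_nonneg_right (EStepCert.check_spec hE).2.1

/-- Monotonicity between arbitrary mesh indices `i ≤ j ≤ N` (fast checker).
[cite: Moore1979, §8.1 eq. (8.13)] -/
theorem EDChainCert.mesh_monoS (c : EDChainCert n) (hc : c.checkS = true) {i j : ℕ} (hij : i ≤ j)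
    (hjN : j ≤ c.size) : c.toHOEChain.mesh i ≤ c.toHOEChain.mesh j := by
  induction j with
  | zero => simp [Nat.le_zero.1 hij]
  | succ j ih =>
    rcases Nat.of_le_succ hij with hij' | hij'
    · exact (ih hij' (Nat.le_of_succ_le hjN)).trans (c.mesh_le_succS hc (Nat.lt_of_succ_le hjN))
    · rw [hij']

/-- **A-priori boxes cover the whole time interval** (fast checker; from a box of initial values):
every solution from `y₀ ∈ W` on `[0, τ_N]` lies, at EVERY `t ∈ [0, τ_N]`, in the a-priori box of
SOME stage `k < N` (the covering `EDChainCert.exists_mesh_Icc` of the tree + `mem_apriori_of_boxS`).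
[cite: MrozekZgliczynski2000, §7.5 Lemma 7.6] [cite: Moore1979, §8.1 eq. (8.13)] -/
theorem EDChainCert.exists_mem_apriori_of_boxS (c : EDChainCert n) (hc : c.checkS = true)
    (hN : 0 < c.size) (hC : isOneQ (c.nodeAt 0).cmat = true)
    (hR : boxLE (pointBox 0) (c.nodeAt 0).rem = true)
    {W : Fin n → Iv} (hW : boxLE (shiftBox W (c.nodeAt 0).center) c.r0 = true)
    {y : ℝ → Fin n → ℝ} (hy0 : y 0 ∈ boxSet (castBox W))
    (hy : ∀ t ∈ Icc (0 : ℝ) (c.toHOEChain.mesh c.size),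
      HasDerivWithinAt y (fieldFun c.field (y t)) (Icc (0 : ℝ) (c.toHOEChain.mesh c.size)) t)
    {t : ℝ} (ht : t ∈ Icc (0 : ℝ) (c.toHOEChain.mesh c.size)) :
    ∃ k < c.size, y t ∈ boxSet (castBox (c.stageAt k).apriori) := by
  obtain ⟨k, hk, hkt⟩ := c.exists_mesh_Icc hN ht
  exact ⟨k, hk, c.mem_apriori_of_boxS hc hC hR hW hy0 hy hk hkt⟩

end Literature.Analysis.ODE
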